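import Literature.AlgebraicGeometry.Motives.HodgeStructureLefschetzGroupPoints
import Literature.AlgebraicGeometry.Motives.HodgeStructurePolarizationAsMorphism
import HarnessLib

/-!
# Milne 1999, Proposition 1.3 on a polarized `ℚ`-Hodge structure: the bilinear forms on `V` compatible with `†` on
# Milne's centraliser `C(H) = End_{E_φ}(V)` are exactly the twists `Q(β ·, ·)`, `β ∈ E_φ`, of the polarization — equivalently
# the morphisms `H ⊗ H → ℚ(-n)`, equivalently the `Hg(H)(ℚ)`-invariant (= the `S(H)(ℚ)`-invariant) forms; parity `⟺ β† = β`

[topic AlgebraicGeometry/Motives]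

Layer `Literature/AlgebraicGeometry/Motives`, lane `lit-hodgefound` (Track 2 foundations library; seat `lit-hodgefound-p34`,
generation 18, self-proposed row g18-#2 of `run/shared/lean/pub/lit-hodgefound/SKELETON.md`). THEOREMS ONLY (no definition,
no named fact; net debt `0`). Sequel of g18-#1 `Motives/HodgeStructureLefschetzGroupPoints` (Milne §1: `C(H)`, `†|_{C(H)}`,
Remark 1.2, `S(H)`, `G(H)` on points), same carrier: an abstract pure `ℚ`-Hodge structure `H : HodgeStructure V n` of any
weight on a finite-dimensional `V` with a polarization `Q`, `E_φ = H.endAlg`, `C(H) = Subalgebra.centralizer ℚ ↑E_φ`,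
`a† = Q.adjoint a`. The torus-level `k = ℚ` version of the same Proposition (lattice matrices, `NS_ℚ(X)`, Gram matrices)
is the tree's `Literature/Geometry/Kaehler/ComplexTorusCentralizerSkewForms` (p22) — another carrier, BY NAME, nothing of
it is imported or restated; the `ℂ`-points `H¹(A(ℂ); ℂ)` half-version is `Milne1999/CentraliserFixesDivisorClasses` (BY NAME).

## The source, verbatim

J. S. Milne, *Lefschetz classes on abelian varieties*, Duke Math. J. **96** (1999) 639–675 [Milne1999LefschetzClasses]
(held `paper:doi-10-1215-s0012-7094-99-09620-5`, author's folios; Duke page ≈ folio + 638):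

* p0005 L34–L37 (p. 643): "**Proposition 1.3.** The skew-symmetric `k`-bilinear forms `ψ : V(A) × V(A) → k(1)` such
  that `ψ ∘ (γ × 1) = ψ ∘ (1 × γ†)`, all `γ ∈ C(A)`, are exactly the `k`-linear combinations of forms `e_D` with `D` a
  divisor on `A`." Proof (p0005 L38–p0006 L2): "Let `D₀` be an ample divisor on `A`, and let `†` be the involution it defines
  on `End_k(V(A))`. As we noted above, if `D` is a second divisor on `A`, then `e_D = e_{D₀} ∘ (α × 1)` for some
  `α ∈ End⁰(A)`. This implies that `e_D ∘ (γ × 1) = e_D ∘ (1 × γ†)` for all `γ ∈ C(A)`. Conversely, because `e_{D₀}` is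
  non-degenerate, any `k`-bilinear form `ψ : V(A) × V(A) → k(1)` can be written `ψ = e_{D₀} ∘ (β × 1)` for some
  `β ∈ End_k(V(A))`. If `ψ` is skew-symmetric, then `β = β†`, and
  **(1.2)** `ψ ∘ (γ × 1) = ψ ∘ (1 × γ†), ∀γ ∈ C(A) ⟹ βγ = γβ, ∀γ ∈ C(A) ⟹ β ∈ End⁰(A) ⊗_ℚ k`.
  Therefore, any `ψ` as in the statement of the proposition is of the form `e_{D₀} ∘ (β × 1)` for some `β ∈ End⁰(A) ⊗_ℚ k`
  with `β = β†`. Hence `β = Σ cᵢβᵢ` with `cᵢ ∈ k`, `βᵢ ∈ End⁰(A)`, `βᵢ† = βᵢ`. According to (Mumford 1970, p208),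
  `e_{D₀} ∘ (βᵢ × 1)` is of the form `e_{Dᵢ}` for a divisor `Dᵢ` on `A`, which completes the proof."
* p0006 L3–L6 (p. 644), **Remark 1.4**: "Let `A` be an abelian variety over `ℂ`, and let `V = V_B(A)`. To give `C(A)` with
  its action on `V` is the same as to give `End⁰(A)` with its action on `V`, and **to give the involution `†` on `C(A)` is the
  same as to give the set `{e_D | D a divisor on A}`.**"
* p0015 L35–L40 (p. 653), proof of Prop. 3.3: "We have to show that the space of skew-symmetric forms
  `ψ : V(A) × V(A) → k(1)` invariant under the action of `S(A)` on `Hom(Λ²V(A), k(1))` is generated by the forms `e_D` with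
  `D` a divisor on `A`. But, **because `γ†γ = 1` for `γ ∈ S(A)(k)`, `ψ` is invariant under `S(A)` if and only if
  `ψ ∘ (γ × 1) = ψ ∘ (1 × γ†)`, all `γ ∈ S(A)(k)`**."
* D. Mumford, *Abelian Varieties* (1970) [MumfordAV1970], §20–§21, Application III p. 208 (through Milne): the divisor
  classes `NS(A) ⊗ ℚ` correspond to the Rosati-symmetric elements of `End⁰(A)`, `D ↦ φ_{D₀}⁻¹ φ_D`, i.e.
  `e_D = e_{D₀} ∘ (β_D × 1)` with `β_D† = β_D` — so that "the `k`-linear combinations of forms `e_D`" ARE the forms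
  `e_{D₀} ∘ (β × 1)`, `β ∈ End⁰(A)`, `β† = β` (the shape in which Milne's own proof concludes).
* B. Moonen, *Families of Motives and the Mumford–Tate Conjecture* (2017) [Moonen2017FamiliesMotives] §2.1 / P. Deligne,
  *Théorie de Hodge II* 2.1.15: "a polarization of `H` is a morphism of Hodge structures `φ : H ⊗ H → ℚ(−n)`" — on the
  abstract carrier "`D` a divisor" ↦ "a Hodge class of type `(0,0)` in `(V ⊗ V)^∨(-n)`", i.e. a bilinear form `B` with
  `v ⊗ w ↦ B(v, w)` a morphism `H ⊗ H → ℚ(-n)` (the tree's `homOfBilinForm`, `form_apply_eq_zero_iff_map_F_le`,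
  `Motives/HodgeStructurePolarizationAsMorphism`).

## What is PROVED (for a polarized `(H, Q)` and a bilinear form `B` on `V`; `ε = (-1)ⁿ`)

* §1 "because `e_{D₀}` is non-degenerate, any `k`-bilinear form `ψ` can be written `ψ = e_{D₀} ∘ (β × 1)`":
  `Polarization.form_toDualEquiv_symm_comp_apply` (`β_B = θ⁻¹ ∘ B♭` works), `Polarization.existsUnique_form_comp`
  (**`∃! β, ∀ v w, B(v, w) = Q(β v, w)`**). Everything below is stated for ANY `β` with `hβ : ∀ v w, B(v, w) = Q(β v, w)`.
* §2 **(1.2), both arrows, as equivalences**: `ψ ∘ (γ × 1) = ψ ∘ (1 × γ†) ∀γ ∈ C(A)` `⟺ βγ = γβ ∀γ ∈ C(A)`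
  (`forall_centralizer_form_apply_adjoint_iff_forall_comm`, no hypothesis on `H`) `⟺ β ∈ E_φ`
  (`forall_centralizer_form_apply_adjoint_iff_mem_endAlg`, Remark 1.2 = g18-#1's `mem_endAlg_iff_forall_centralizer_endAlg_comm`);
  hence **Proposition 1.3 on this carrier**: **`forall_centralizer_form_apply_adjoint_iff_exists_mem_endAlg`** — the
  `†`-equivariant forms under `C(H)` are EXACTLY the `Q(β ·, ·)`, `β ∈ E_φ`.
* §3 "If `ψ` is skew-symmetric, then `β = β†`": for `B = Q(β ·, ·)`, `B(w, v) = ε B(v, w) ∀ v w ⟺ β† = β`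
  (`forall_form_swap_iff_adjoint_eq_self`); the printed skew/symmetric statement:
  **`forall_centralizer_form_apply_adjoint_and_swap_iff`** — `†`-equivariant AND of parity `ε` `⟺ ∃ β ∈ E_φ, β† = β ∧ B = Q(β·,·)`.
* §4 Remark 1.4 / Prop. 3.3's sentence, and the Hodge group: for `B = Q(β ·, ·)`, `B` is `Hg(H)(ℚ)`-invariant `⟺ β ∈ E_φ`
  (`forall_hodgeGroup_form_apply_apply_iff_mem_endAlg`: `Q` is a Hodge tensor and `E_φ = Z(Hg(H)(ℚ))`, EVERY pure `ℚ`-HS);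
  `†`-equivariance under `C(H)` ⟹ invariance under `S(H)(ℚ)` (`forall_lefschetzGroup_form_apply_apply_of_forall_centralizer`,
  "because `γ†γ = 1` for `γ ∈ S(A)(k)`") ⟹ invariance under `Hg(H)(ℚ) ≤ S(H)(ℚ)` ⟹ `†`-equivariance: so **the
  `S(H)(ℚ)`-invariant, the `Hg(H)(ℚ)`-invariant and the `C(H)`-`†`-equivariant bilinear forms on `V` coincide**
  (`forall_lefschetzGroup_form_apply_apply_iff_forall_centralizer`, `forall_hodgeGroup_form_apply_apply_iff_forall_centralizer`;
  Milne's Thm. 3.2 / Cor. 4.5 in degree `2`, `r = 1`, on `ℚ`-points of this carrier: `S(H)(ℚ)` and `Hg(H)(ℚ)` fix the same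
  `2`-forms).
* §5 The Hodge-theoretic reading of "`D` a divisor": for `B = Q(β ·, ·)`, `B_ℂ(Fᵖ, F^{n+1-p}) = 0` (the morphism condition
  `H ⊗ H → ℚ(-n)`) `⟺ β ∈ E_φ` (`forall_F_baseChange_form_eq_zero_iff_mem_endAlg`; `F^p = (F^{n+1-p})^{⊥_Q}`, the tree's
  `Polarization.mem_F_iff`); hence `†`-equivariance under `C(H)` `⟺` `v ⊗ w ↦ B(v, w)` is a morphism `H ⊗ H → ℚ(-n)`
  (`forall_centralizer_form_apply_adjoint_iff_forall_F`, `forall_centralizer_form_apply_adjoint_iff_exists_hom`).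
* §6 `forall_centralizer_form_apply_adjoint_tfae` — the six readings in one `List.TFAE`.

NOT here: `k`-points for `k ≠ ℚ` (Milne's coefficient field; the `K ⊗ V` version needs the `K`-bicommutant of g16-#3 and is
left to a later row); the ample cone of Remark 1.4; powers `A^r` (Thm. 3.2 for `r > 1`); "`k`-linear combinations of the
`e_D`" as a statement about Néron–Severi groups of abelian varieties (other carriers: `Kaehler/ComplexTorusCentralizerSkewForms`,
`Kaehler/ComplexTorusNeronSeveriEndomorphisms`, `Milne1999/DivisorClassesSymmetricCentralizer` — BY NAME).

## References

* [Milne1999LefschetzClasses] J. S. Milne, *Lefschetz classes on abelian varieties*, Duke Math. J. 96 (1999) 639–675, §1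
  Proposition 1.3 with its proof and (1.2) (p. 643), Remark 1.4 (p. 644), proof of Proposition 3.3 (p. 653).
* [MumfordAV1970] D. Mumford, *Abelian Varieties* (1970), §20–§21, Application III p. 208.
* [Moonen2017FamiliesMotives] B. Moonen, *Families of Motives and the Mumford–Tate Conjecture*, Milan J. Math. 85 (2017), §2.1.
* [DeligneHodgeII1971] P. Deligne, *Théorie de Hodge II*, Publ. Math. IHÉS 40 (1971), 2.1.15.
* [Huybrechts2016K3] D. Huybrechts, *Lectures on K3 Surfaces*, CUP (2016), §3.3.5 eq. (3.3), Lemma 3.3.12 (proof: `F^p` as a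
  `ψ`-orthogonal).
-/

noncomputable section

open scoped TensorProduct

namespace Literature.AlgebraicGeometry.Motives

namespace HodgeStructure

universe u

variable {V : Type u} [AddCommGroup V] [Module ℚ V] [Module.Finite ℚ V] {n : ℤ} {H : HodgeStructure V n}
  (Q : Polarization H)

/-! ## §1 Every bilinear form is a twist `Q(β ·, ·)` of the polarization, for a unique `β` -/

/-- **"because `e_{D₀}` is non-degenerate, any `k`-bilinear form `ψ` can be written `ψ = e_{D₀} ∘ (β × 1)` for some
`β ∈ End_k(V(A))`"** — explicitly `β = θ⁻¹ ∘ B♭` (`θ = Q♭ : V ≃ V^∨`, the tree's `Polarization.toDualEquiv`):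
`Q((θ⁻¹ ∘ B♭) v, w) = B(v, w)`. [cite: Milne1999LefschetzClasses, §1 Prop. 1.3 (proof, p. 643)] -/
theorem Polarization.form_toDualEquiv_symm_comp_apply (B : LinearMap.BilinForm ℚ V) (v w : V) :
    Q.form (((Q.toDualEquiv.symm : Module.Dual ℚ V →ₗ[ℚ] V) ∘ₗ B) v) w = B v w := by
  rw [LinearMap.comp_apply, LinearEquiv.coe_coe, Q.form_toDualEquiv_symm]

/-- `ψ = e_{D₀} ∘ (β × 1)` for a UNIQUE `β` (`e_{D₀}` non-degenerate): `∃! β, ∀ v w, B(v, w) = Q(β v, w)`.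
[cite: Milne1999LefschetzClasses, §1 Prop. 1.3 (proof, p. 643)] -/
theorem Polarization.existsUnique_form_comp (B : LinearMap.BilinForm ℚ V) :
    ∃! β : Module.End ℚ V, ∀ v w, B v w = Q.form (β v) w := by
  refine ⟨(Q.toDualEquiv.symm : Module.Dual ℚ V →ₗ[ℚ] V) ∘ₗ B,
    fun v w ↦ (Q.form_toDualEquiv_symm_comp_apply B v w).symm, fun β hβ ↦ LinearMap.ext fun v ↦ ?_⟩
  rw [← sub_eq_zero]
  refine Q.nondegenerate.1 _ fun w ↦ ?_
  rw [map_sub, LinearMap.sub_apply, ← hβ v w, Q.form_toDualEquiv_symm_comp_apply, sub_self]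

/-! ## §2 (1.2): `†`-equivariance under `C(H)` `⟺ β` commutes with `C(H)` `⟺ β ∈ E_φ` — Proposition 1.3 -/

section OneTwo

variable {Q} {B : LinearMap.BilinForm ℚ V} {β : Module.End ℚ V}

/-- **(1.2), first arrow, as an equivalence** (no hypothesis on `H`): for `B = Q(β ·, ·)`,
`B(γ v, w) = B(v, γ† w)` for all `γ ∈ C(H)` iff `β` commutes with every `γ ∈ C(H)` — since `B(γ v, w) = Q(β γ v, w)` and
`B(v, γ† w) = Q(β v, γ† w) = Q(γ β v, w)`, and `Q` is non-degenerate. [cite: Milne1999LefschetzClasses, §1 (1.2) (p. 643)] -/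
theorem Polarization.forall_centralizer_form_apply_adjoint_iff_forall_comm (hβ : ∀ v w, B v w = Q.form (β v) w) :
    (∀ c ∈ Subalgebra.centralizer ℚ (H.endAlg : Set (Module.End ℚ V)), ∀ v w, B (c v) w = B v (Q.adjoint c w)) ↔
      ∀ c ∈ Subalgebra.centralizer ℚ (H.endAlg : Set (Module.End ℚ V)), c * β = β * c := by
  have key : ∀ c : Module.End ℚ V, (∀ v w, B (c v) w = B v (Q.adjoint c w)) ↔ c * β = β * c := by
    intro c
    constructor
    · intro h
      refine LinearMap.ext fun v ↦ ?_
      rw [← sub_eq_zero]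
      refine Q.nondegenerate.1 _ fun w ↦ ?_
      rw [map_sub, LinearMap.sub_apply, Module.End.mul_apply, Module.End.mul_apply, ← Q.form_apply_adjoint c (β v) w,
        ← hβ v (Q.adjoint c w), ← h v w, hβ (c v) w, sub_self]
    · intro h v w
      rw [hβ (c v) w, hβ v (Q.adjoint c w), Q.form_apply_adjoint c (β v) w, ← Module.End.mul_apply, ← h,
        Module.End.mul_apply]
  exact ⟨fun h c hc ↦ (key c).1 (h c hc), fun h c hc ↦ (key c).2 (h c hc)⟩

variable [HodgeTensorFacts.{u, u}]

/-- **(1.2), both arrows, as an equivalence: `ψ ∘ (γ × 1) = ψ ∘ (1 × γ†) ∀γ ∈ C(A) ⟺ β ∈ End⁰(A)`** — for `B = Q(β ·, ·)`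
on a polarized `ℚ`-Hodge structure, `†`-equivariance under `C(H)` holds iff `β ∈ E_φ` (the commutant of `C(H)` is `E_φ`,
Remark 1.2 = g18-#1's `mem_endAlg_iff_forall_centralizer_endAlg_comm`; "`⟸`": "This implies that
`e_D ∘ (γ × 1) = e_D ∘ (1 × γ†)` for all `γ ∈ C(A)`"). [cite: Milne1999LefschetzClasses, §1 (1.2) and Prop. 1.3 (proof, p. 643)] -/
theorem Polarization.forall_centralizer_form_apply_adjoint_iff_mem_endAlg (hβ : ∀ v w, B v w = Q.form (β v) w) :
    (∀ c ∈ Subalgebra.centralizer ℚ (H.endAlg : Set (Module.End ℚ V)), ∀ v w, B (c v) w = B v (Q.adjoint c w)) ↔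
      β ∈ H.endAlg := by
  rw [Polarization.forall_centralizer_form_apply_adjoint_iff_forall_comm hβ,
    mem_endAlg_iff_forall_centralizer_endAlg_comm H ⟨Q⟩ β]

variable (Q) (B) in
/-- **Proposition 1.3 on the abstract polarized `ℚ`-Hodge structure**: a bilinear form `B` on `V` satisfies
`B(γ v, w) = B(v, γ† w)` for all `γ ∈ C(H) = End_{E_φ}(V)` if and only if `B = Q(β ·, ·)` for some Hodge endomorphism
`β ∈ E_φ` ("exactly the `k`-linear combinations of forms `e_D`", with `e_D = e_{D₀} ∘ (β_D × 1)`, `β_D ∈ End⁰(A)`, Mumford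
p. 208; the parity clause is §3). [cite: Milne1999LefschetzClasses, §1 Prop. 1.3 (p. 643)] [cite: MumfordAV1970, §20–§21 Application III p. 208] -/
theorem Polarization.forall_centralizer_form_apply_adjoint_iff_exists_mem_endAlg :
    (∀ c ∈ Subalgebra.centralizer ℚ (H.endAlg : Set (Module.End ℚ V)), ∀ v w, B (c v) w = B v (Q.adjoint c w)) ↔
      ∃ β ∈ H.endAlg, ∀ v w, B v w = Q.form (β v) w := by
  obtain ⟨β, hβ, -⟩ := Q.existsUnique_form_comp B
  rw [Polarization.forall_centralizer_form_apply_adjoint_iff_mem_endAlg hβ]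
  refine ⟨fun h ↦ ⟨β, h, hβ⟩, fun ⟨β', hβ', h'⟩ ↦ ?_⟩
  obtain rfl : β = β' := (Q.existsUnique_form_comp B).unique hβ h'
  exact hβ'

end OneTwo

/-! ## §3 Parity: "If `ψ` is skew-symmetric, then `β = β†`" -/

section Parity

variable {Q} {B : LinearMap.BilinForm ℚ V} {β : Module.End ℚ V}

omit [Module.Finite ℚ V] in
/-- `(-1)ⁿ · (-1)ⁿ = 1` in `ℚ`. [folklore] -/
private theorem negOnePow_ratCast_mul_self' :
    (((n.negOnePow : ℤˣ) : ℤ) : ℚ) * (((n.negOnePow : ℤˣ) : ℤ) : ℚ) = 1 := by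
  rw [← Int.cast_mul, ← Units.val_mul, Int.units_mul_self, Units.val_one, Int.cast_one]

/-- **"If `ψ` is skew-symmetric, then `β = β†`"**, as an equivalence and in every weight: for `B = Q(β ·, ·)` with `Q` of parity
`ε = (-1)ⁿ`, `B` has parity `ε` (`B(w, v) = ε B(v, w)` for all `v, w`; skew for odd `n`, symmetric for even `n`) iff `β† = β`.
Indeed `B(w, v) = Q(β w, v) = ε Q(v, β w) = ε Q(β† v, w)`. [cite: Milne1999LefschetzClasses, §1 Prop. 1.3 (proof, p. 643: "If ψ is skew-symmetric, then β = β†")] -/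
theorem Polarization.forall_form_swap_iff_adjoint_eq_self (hβ : ∀ v w, B v w = Q.form (β v) w) :
    (∀ v w, B w v = (((n.negOnePow : ℤˣ) : ℤ) : ℚ) * B v w) ↔ Q.adjoint β = β := by
  have hswap : ∀ v w, B w v = (((n.negOnePow : ℤˣ) : ℤ) : ℚ) * Q.form (Q.adjoint β v) w := fun v w ↦ by
    rw [hβ w v, Q.form_swap v (β w), (Q.isAdjointPair_adjoint_left β v w : Q.form (Q.adjoint β v) w = Q.form v (β w))]
  constructor
  · intro h
    refine LinearMap.ext fun v ↦ ?_
    rw [← sub_eq_zero]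
    refine Q.nondegenerate.1 _ fun w ↦ ?_
    have h1 := h v w
    rw [hswap v w, hβ v w] at h1
    have h2 := mul_left_cancel₀ (by
      intro h0
      have := negOnePow_ratCast_mul_self' (n := n)
      rw [h0, zero_mul] at this
      exact zero_ne_one this) h1
    rw [map_sub, LinearMap.sub_apply, h2, sub_self]
  · intro h v w
    rw [hswap v w, h, hβ v w]

variable [HodgeTensorFacts.{u, u}]

variable (Q) (B) in
/-- **Proposition 1.3 with its parity clause** ("The skew-symmetric `k`-bilinear forms `ψ` such that
`ψ ∘ (γ × 1) = ψ ∘ (1 × γ†)`, all `γ ∈ C(A)`, are exactly …" the forms `e_{D₀} ∘ (β × 1)` with `β ∈ End⁰(A)`, `β = β†`): a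
bilinear form `B` on `V` is `†`-equivariant under `C(H)` and of the parity `ε = (-1)ⁿ` of `Q` iff `B = Q(β ·, ·)` for some
`β ∈ E_φ` with `β† = β`. [cite: Milne1999LefschetzClasses, §1 Prop. 1.3 and its proof (p. 643)] [cite: MumfordAV1970, §20–§21 Application III p. 208] -/
theorem Polarization.forall_centralizer_form_apply_adjoint_and_swap_iff :
    ((∀ c ∈ Subalgebra.centralizer ℚ (H.endAlg : Set (Module.End ℚ V)), ∀ v w, B (c v) w = B v (Q.adjoint c w)) ∧
        ∀ v w, B w v = (((n.negOnePow : ℤˣ) : ℤ) : ℚ) * B v w) ↔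
      ∃ β ∈ H.endAlg, Q.adjoint β = β ∧ ∀ v w, B v w = Q.form (β v) w := by
  obtain ⟨β, hβ, -⟩ := Q.existsUnique_form_comp B
  rw [Polarization.forall_centralizer_form_apply_adjoint_iff_mem_endAlg hβ, Polarization.forall_form_swap_iff_adjoint_eq_self hβ]
  refine ⟨fun h ↦ ⟨β, h.1, h.2, hβ⟩, fun ⟨β', hβ', hadj, h'⟩ ↦ ?_⟩
  obtain rfl : β = β' := (Q.existsUnique_form_comp B).unique hβ h'
  exact ⟨hβ', hadj⟩

end Parity

/-! ## §4 Invariance under `Hg(H)(ℚ)` and under `S(H)(ℚ)`: "`ψ` is invariant under `S(A)` iff `ψ ∘ (γ × 1) = ψ ∘ (1 × γ†)`" -/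

section Invariance

variable {Q} {B : LinearMap.BilinForm ℚ V} {β : Module.End ℚ V}

variable [HodgeTensorFacts.{u, u}]

/-- **A twist `B = Q(β ·, ·)` is invariant under the Hodge group `Hg(H)(ℚ)` iff `β ∈ E_φ`** (every pure `ℚ`-HS with a
polarization): `Q` is `Hg(H)(ℚ)`-invariant (a Hodge tensor; the tree's `Polarization.form_apply_apply_of_mem_hodgeGroup`), so
`B(g v, g w) = Q(g⁻¹ β g v, w)`, and `E_φ` is the commutant of `Hg(H)(ℚ)` (the tree's `endAlg_eq_centralizer_hodgeGroup`). This is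
Remark 1.4's "to give `†` on `C(A)` is the same as to give the set `{e_D}`" read through the Hodge group: the divisor-type forms
are the Hodge classes among the `2`-forms. [cite: Milne1999LefschetzClasses, §1 Remark 1.4 (p. 644) and §4 p. 660]
[cite: Moonen2017FamiliesMotives, §2.1] -/
theorem Polarization.forall_hodgeGroup_form_apply_apply_iff_mem_endAlg (hβ : ∀ v w, B v w = Q.form (β v) w) :
    (∀ g ∈ H.hodgeGroup, ∀ v w, B (g v) (g w) = B v w) ↔ β ∈ H.endAlg := by
  rw [endAlg_eq_centralizer_hodgeGroup, Subalgebra.mem_centralizer_iff]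
  constructor
  · rintro h _ ⟨g, hg, rfl⟩
    -- `g β = β g`: test `Q(β g v, g w') = B(g v, g w') = B(v, w') = Q(β v, w') = Q(g β v, g w')`
    refine LinearMap.ext fun v ↦ ?_
    rw [Module.End.mul_apply, Module.End.mul_apply, LinearEquiv.coe_coe, ← sub_eq_zero]
    refine Q.nondegenerate.1 _ fun w ↦ ?_
    obtain ⟨w', rfl⟩ : ∃ w', g w' = w := ⟨g.symm w, g.apply_symm_apply w⟩
    rw [map_sub, LinearMap.sub_apply, Q.form_apply_apply_of_mem_hodgeGroup hg, ← hβ, ← hβ, h g hg, sub_self]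
  · intro h g hg v w
    have hc : β (g v) = g (β v) := by
      have := LinearMap.congr_fun (h _ ⟨g, hg, rfl⟩) v
      simpa only [Module.End.mul_apply, LinearEquiv.coe_coe] using this.symm
    rw [hβ, hβ, hc, Q.form_apply_apply_of_mem_hodgeGroup hg]

/-- **"because `γ†γ = 1` for `γ ∈ S(A)(k)`, `ψ` is invariant under `S(A)` if [and only if] `ψ ∘ (γ × 1) = ψ ∘ (1 × γ†)`"** —
the "if" on `ℚ`-points: a bilinear form `†`-equivariant under `C(H)` is invariant under Milne's `S(H)(ℚ)` (g18-#1's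
`Polarization.lefschetzGroup`: `γ ∈ C(H)`, `γ†γ = 1`), for ANY auxiliary polarization `Q'` defining `S`.
[cite: Milne1999LefschetzClasses, §3 proof of Prop. 3.3 (p. 653)] -/
theorem Polarization.forall_lefschetzGroup_form_apply_apply_of_forall_centralizer (Q' : Polarization H)
    (h : ∀ c ∈ Subalgebra.centralizer ℚ (H.endAlg : Set (Module.End ℚ V)), ∀ v w, B (c v) w = B v (Q.adjoint c w)) :
    ∀ g ∈ Q'.lefschetzGroup, ∀ v w, B (g v) (g w) = B v w := by
  intro g hg v w
  rw [Q'.lefschetzGroup_eq_of_polarization Q, Q.mem_lefschetzGroup_iff_adjoint_mul_self_eq_one] at hg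
  have h1 := h _ hg.1 v (g w)
  rw [LinearEquiv.coe_coe] at h1
  rw [h1, ← LinearEquiv.coe_coe g, ← Module.End.mul_apply, hg.2, Module.End.one_apply]

variable (Q) (B) in
/-- **The `S(H)(ℚ)`-invariant bilinear forms on `V` are exactly the `C(H)`-`†`-equivariant ones** (and hence, §2, exactly the
`Q(β ·, ·)`, `β ∈ E_φ`): "⟸" is Milne's sentence; "⟹" because `Hg(H)(ℚ) ≤ S(H)(ℚ)` (g18-#1) and `Hg(H)(ℚ)`-invariance already
forces `β ∈ E_φ` (`forall_hodgeGroup_form_apply_apply_iff_mem_endAlg`) — Milne's Theorem 3.2 / Corollary 4.5 in degree `2`,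
`r = 1`, on the `ℚ`-points of this carrier. [cite: Milne1999LefschetzClasses, §3 proof of Prop. 3.3 (p. 653) and Prop. 1.3] -/
theorem Polarization.forall_lefschetzGroup_form_apply_apply_iff_forall_centralizer (Q' : Polarization H) :
    (∀ g ∈ Q'.lefschetzGroup, ∀ v w, B (g v) (g w) = B v w) ↔
      ∀ c ∈ Subalgebra.centralizer ℚ (H.endAlg : Set (Module.End ℚ V)), ∀ v w, B (c v) w = B v (Q.adjoint c w) := by
  obtain ⟨β, hβ, -⟩ := Q.existsUnique_form_comp B
  refine ⟨fun h ↦ ?_, Q.forall_lefschetzGroup_form_apply_apply_of_forall_centralizer Q'⟩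
  rw [Polarization.forall_centralizer_form_apply_adjoint_iff_mem_endAlg hβ,
    ← Polarization.forall_hodgeGroup_form_apply_apply_iff_mem_endAlg hβ]
  exact fun g hg ↦ h g (Q'.hodgeGroup_le_lefschetzGroup hg)

variable (Q) (B) in
/-- **The `Hg(H)(ℚ)`-invariant bilinear forms on `V` are exactly the `C(H)`-`†`-equivariant ones** (`S(H)(ℚ)` and `Hg(H)(ℚ)`
have the same invariant `2`-forms: no "exotic" classes in degree `2`, cf. Milne p. 660).
[cite: Milne1999LefschetzClasses, §1 Prop. 1.3, §3 proof of Prop. 3.3 and §4 p. 660] -/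
theorem Polarization.forall_hodgeGroup_form_apply_apply_iff_forall_centralizer :
    (∀ g ∈ H.hodgeGroup, ∀ v w, B (g v) (g w) = B v w) ↔
      ∀ c ∈ Subalgebra.centralizer ℚ (H.endAlg : Set (Module.End ℚ V)), ∀ v w, B (c v) w = B v (Q.adjoint c w) := by
  obtain ⟨β, hβ, -⟩ := Q.existsUnique_form_comp B
  rw [Polarization.forall_hodgeGroup_form_apply_apply_iff_mem_endAlg hβ,
    Polarization.forall_centralizer_form_apply_adjoint_iff_mem_endAlg hβ]

end Invariance

/-! ## §5 The Hodge-theoretic reading: `†`-equivariant under `C(H)` `⟺` `v ⊗ w ↦ B(v, w)` is a morphism `H ⊗ H → ℚ(-n)` -/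

section Morphism

variable {Q} {B : LinearMap.BilinForm ℚ V} {β : Module.End ℚ V}

omit [Module.Finite ℚ V] in
/-- `B = Q(β ·, ·)` after complexification: `B_ℂ(x, y) = Q_ℂ(β_ℂ x, y)`. Private plumbing. [folklore] -/
private theorem Polarization.baseChange_form_eq_of_form_eq (hβ : ∀ v w, B v w = Q.form (β v) w) (x y : ℂ ⊗[ℚ] V) :
    B.baseChange ℂ x y = Q.form.baseChange ℂ (β.baseChange ℂ x) y := by
  induction x using TensorProduct.induction_on with
  | zero => simp only [map_zero, LinearMap.zero_apply]
  | tmul c v =>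
    induction y using TensorProduct.induction_on with
    | zero => simp only [map_zero]
    | tmul c' w => simp only [LinearMap.baseChange_tmul, LinearMap.BilinForm.baseChange_tmul, hβ]
    | add y y' hy hy' => simp only [map_add, hy, hy']
  | add x x' hx hx' => simp only [map_add, LinearMap.add_apply, hx, hx']

omit [Module.Finite ℚ V] in
/-- **For `B = Q(β ·, ·)`: `B_ℂ(Fᵖ, F^{n+1-p}) = 0` for all `p` (the first Hodge–Riemann orthogonality, i.e. `v ⊗ w ↦ B(v, w)`
is a morphism `H ⊗ H → ℚ(-n)`) iff `β ∈ E_φ`** — `⟸`: `β_ℂ x ∈ Fᵖ` and `Q`'s first bilinear relation; `⟹`: `Fᵖ` is the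
`Q_ℂ`-orthogonal of `F^{n+1-p}` (the tree's `Polarization.mem_F_iff`, Huybrechts Lemma 3.3.12's proof), so `β_ℂ x ∈ Fᵖ`.
[cite: Moonen2017FamiliesMotives, §2.1 (a polarization is a morphism H ⊗ H → ℚ(−n))] [cite: Huybrechts2016K3, Lemma 3.3.12 (proof)]
[cite: Milne1999LefschetzClasses, §1 Remark 1.4 (p. 644)] -/
theorem Polarization.forall_F_baseChange_form_eq_zero_iff_mem_endAlg (hβ : ∀ v w, B v w = Q.form (β v) w) :
    (∀ p, ∀ x ∈ H.F p, ∀ y ∈ H.F (n + 1 - p), B.baseChange ℂ x y = 0) ↔ β ∈ H.endAlg := by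
  constructor
  · intro h p
    rintro _ ⟨x, hx, rfl⟩
    refine (Q.mem_F_iff p _).2 fun y hy ↦ ?_
    rw [Q.form_baseChange_swap, ← Q.baseChange_form_eq_of_form_eq hβ, h p x hx y hy, mul_zero]
  · intro hmem p x hx y hy
    rw [Q.baseChange_form_eq_of_form_eq hβ]
    exact Q.form_apply_eq_zero p _ (hmem p ⟨x, hx, rfl⟩) y hy

variable [HodgeTensorFacts.{u, u}]

variable (Q) (B) in
/-- **`†`-equivariance under `C(H)` `⟺` the first Hodge–Riemann orthogonality of `B`** (`⟺ v ⊗ w ↦ B(v, w)` is a morphism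
`H ⊗ H → ℚ(-n)`, the tree's `form_apply_eq_zero_iff_map_F_le`): the abstract form of "exactly the `k`-linear combinations of
forms `e_D` with `D` a divisor" — the `†`-compatible forms are the Hodge classes among the `2`-forms.
[cite: Milne1999LefschetzClasses, §1 Prop. 1.3 and Remark 1.4] [cite: Moonen2017FamiliesMotives, §2.1] -/
theorem Polarization.forall_centralizer_form_apply_adjoint_iff_forall_F :
    (∀ c ∈ Subalgebra.centralizer ℚ (H.endAlg : Set (Module.End ℚ V)), ∀ v w, B (c v) w = B v (Q.adjoint c w)) ↔
      ∀ p, ∀ x ∈ H.F p, ∀ y ∈ H.F (n + 1 - p), B.baseChange ℂ x y = 0 := by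
  obtain ⟨β, hβ, -⟩ := Q.existsUnique_form_comp B
  rw [Polarization.forall_centralizer_form_apply_adjoint_iff_mem_endAlg hβ,
    Polarization.forall_F_baseChange_form_eq_zero_iff_mem_endAlg hβ]

variable (Q) (B) in
/-- The same with the morphism packaged: `B` is `†`-equivariant under `C(H)` iff there is a morphism of Hodge structures
`f : H ⊗ H → ℚ(-n)` with underlying map `v ⊗ w ↦ B(v, w)` (the tree's `homOfBilinForm`). [cite: Milne1999LefschetzClasses, §1 Prop. 1.3 and Remark 1.4]
[cite: DeligneHodgeII1971, 2.1.15] -/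
theorem Polarization.forall_centralizer_form_apply_adjoint_iff_exists_hom :
    (∀ c ∈ Subalgebra.centralizer ℚ (H.endAlg : Set (Module.End ℚ V)), ∀ v w, B (c v) w = B v (Q.adjoint c w)) ↔
      ∃ f : Hom (H.tensor H) ((HodgeStructure.tate (-n)).cast (tate_neg_weight n)), f.toLinearMap = TensorProduct.lift B := by
  rw [Q.forall_centralizer_form_apply_adjoint_iff_forall_F B]
  refine ⟨fun h ↦ ⟨homOfBilinForm H B h, homOfBilinForm_toLinearMap H B h⟩, fun ⟨f, hf⟩ ↦ ?_⟩
  rw [form_apply_eq_zero_iff_map_F_le, ← hf]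
  exact f.map_F_le

end Morphism

/-! ## §6 Summary -/

section TFAE

variable [HodgeTensorFacts.{u, u}]

/-- **Milne 1999, Prop. 1.3 / (1.2) / Remark 1.4 / proof of Prop. 3.3 on a polarized `ℚ`-Hodge structure — the six readings
of "a divisor-type `2`-form" agree.** For a bilinear form `B` on `V` TFAE: (1) `B(γ v, w) = B(v, γ† w)` for all `γ ∈ C(H)`;
(2) `B = Q(β ·, ·)` for some `β ∈ E_φ`; (3) `B` is invariant under `Hg(H)(ℚ)`; (4) `B` is invariant under `S(H)(ℚ)`;
(5) `B_ℂ(Fᵖ, F^{n+1-p}) = 0` for all `p`; (6) `v ⊗ w ↦ B(v, w)` underlies a morphism `H ⊗ H → ℚ(-n)`.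
[cite: Milne1999LefschetzClasses, §1 Prop. 1.3, (1.2), Remark 1.4; §3 proof of Prop. 3.3] -/
theorem Polarization.forall_centralizer_form_apply_adjoint_tfae (B : LinearMap.BilinForm ℚ V) :
    List.TFAE
      [∀ c ∈ Subalgebra.centralizer ℚ (H.endAlg : Set (Module.End ℚ V)), ∀ v w, B (c v) w = B v (Q.adjoint c w),
        ∃ β ∈ H.endAlg, ∀ v w, B v w = Q.form (β v) w,
        ∀ g ∈ H.hodgeGroup, ∀ v w, B (g v) (g w) = B v w,
        ∀ g ∈ Q.lefschetzGroup, ∀ v w, B (g v) (g w) = B v w,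
        ∀ p, ∀ x ∈ H.F p, ∀ y ∈ H.F (n + 1 - p), B.baseChange ℂ x y = 0,
        ∃ f : Hom (H.tensor H) ((HodgeStructure.tate (-n)).cast (tate_neg_weight n)),
          f.toLinearMap = TensorProduct.lift B] := by
  tfae_have 1 ↔ 2 := Q.forall_centralizer_form_apply_adjoint_iff_exists_mem_endAlg B
  tfae_have 3 ↔ 1 := Q.forall_hodgeGroup_form_apply_apply_iff_forall_centralizer B
  tfae_have 4 ↔ 1 := Q.forall_lefschetzGroup_form_apply_apply_iff_forall_centralizer B Q
  tfae_have 1 ↔ 5 := Q.forall_centralizer_form_apply_adjoint_iff_forall_F B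
  tfae_have 1 ↔ 6 := Q.forall_centralizer_form_apply_adjoint_iff_exists_hom B
  tfae_finish

end TFAE

end HodgeStructure

end Literature.AlgebraicGeometry.Motives
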